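import Summits.AnomalousDissipation.AnomalousDissipation.Theorems.GalerkinSteadyZerothLaw.Negative.StokesStates
import Literature.Analysis.FluidPDE.NSGalerkinStationary

/-!
# Stub `coat_chart_onto` of the line `idea-sketch-ideator2` (card `euler-core-coat-readout`),
# crux stmt-AnomalousDissipation-2986 (`MirrorVariety.GalerkinSteadyZerothLaw`)

The coat chart is ONTO: every Galerkin steady state `c ∈ galerkinSubspace (modes (Fin 3) N)` of a real solenoidal
force vector `C` at viscosity `ν` (`galerkinRHS S ν C c = 0`) with positive dissipation `D := dissipation ν c` is a
gauged amplitude-clamped coat over the core `C`: with `α := energy C / D`, the vector `h := α • c - C` is real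
solenoidal, `ℓ²`-orthogonal to `C`, and the UNFORCED residual of `C + h = α • c` at viscosity `α ν` is `(-(α²)) • C`.
* membership: `galerkinSubspace` is a real subspace;
* orthogonality: the power identity of the steady state, `D = ∑_k Re⟪C k, c k⟫` (landed
  `LaminarNeverLoud.Negative.dissipation_eq_power`: Temam 1979, Ch. II (1.29) + Parseval), gives
  `∑_k Re⟪C k, h k⟫ = α D - energy C = 0`;
* residual: `galerkinRHS` is affine in the force and the Leray symbol fixes transversal vectors
  (`leraySym_of_transversal`), so `galerkinRHS S ν 0 c = -C`; the unforced Galerkin field is homogeneous of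
  bidegree `(1, 2)` under `(c, ν) ↦ (t c, t ν)` (`coat_chart_onto_galerkinRHS_smul`, the force-free case of the
  tree's `LaminarNeverLoud.Negative.Scaling.galerkinRHS_scale`, proved as in `coatWitness_gauge` from
  `convectionCoeff_smul_left/right` and `leraySym_real_smul`), so `galerkinRHS S (α ν) 0 (α • c) = α² • (-C)`.
References: Temam, *Navier–Stokes Equations* (1979), Ch. II (1.29); Robinson–Rodrigo–Sadowski 2016, §4.1.
-/

noncomputable section

-- `Summit.<Summit>.<Problem>` is the tree's mandated summit-side namespace (CONVENTIONS §2); deliberate duplicate.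
set_option linter.dupNamespace false

open scoped InnerProductSpace Topology
open MeasureTheory Filter Set UnitAddTorus
open Literature.Analysis.FunctionSpaces Literature.Analysis.FunctionSpaces.Torus
open Literature.Analysis.FluidPDE Literature.Analysis.FluidPDE.Torus

namespace Summit.AnomalousDissipation.AnomalousDissipation.Theorems.GalerkinSteadyZerothLaw

open Summit.AnomalousDissipation.AnomalousDissipation.Theorems.GalerkinSteadyZerothLaw.Negative
  (SteadyState BandLimited fieldOf steadyState_fieldOf integral_norm_sq_fieldOf loudness_fieldOf)
open Summit.AnomalousDissipation.AnomalousDissipation.Theorems.LaminarNeverLoud.Negative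
  (modes forceCoeff energy dissipation modes_symm zero_not_mem_modes energy_nonneg dissipation_nonpos_of_nonpos
    isRealCoeff_forceCoeff)

/-- **Homogeneity of the unforced Galerkin field** (bidegree `(1, 2)`): for every real `t`,
`galerkinRHS S (t ν) 0 (t • c) = t² • galerkinRHS S ν 0 c` — the Stokes term is bilinear in `(ν, c)`, the
convection term is quadratic in `c`, and the Leray symbol is real-linear (the force-free case of the scale
covariance `V(tν, t²ĝ)(tc) = t² V(ν, ĝ)(c)`). [folklore] -/
theorem coat_chart_onto_galerkinRHS_smul {N : ℕ} (t ν : ℝ) (c : ↥(modes (Fin 3) N) → EuclideanSpace ℂ (Fin 3)) :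
    galerkinRHS (modes (Fin 3) N) (t * ν) 0 (t • c) = (t ^ 2) • galerkinRHS (modes (Fin 3) N) ν 0 c := by
  -- adapted from `LaminarNeverLoud.Negative.Scaling.galerkinRHS_scale` / `coatWitness_gauge`
  funext k
  rw [Pi.smul_apply, galerkinRHS_apply, galerkinRHS_apply, galerkinField_def, galerkinField_def, coeffExt_smul,
    coeffExt_zero]
  set Cc := coeffExt (modes (Fin 3) N) c
  have hsc : (t • Cc : (Fin 3 → ℤ) → EuclideanSpace ℂ (Fin 3)) = ((t : ℝ) : ℂ) • Cc := by
    funext l; simp only [Pi.smul_apply, Complex.coe_smul]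
  have hconv : convectionCoeff (modes (Fin 3) N) (t • Cc) (t • Cc) (k : Fin 3 → ℤ) =
      (t ^ 2) • convectionCoeff (modes (Fin 3) N) Cc Cc (k : Fin 3 → ℤ) := by
    rw [hsc, convectionCoeff_smul_left, convectionCoeff_smul_right, smul_smul, ← Complex.coe_smul]
    congr 1
    push_cast
    ring
  have hstokes : -((((t * ν) * (4 * Real.pi ^ 2 * freqNormSq (k : Fin 3 → ℤ)) : ℝ) : ℂ) •
        (t • Cc) (k : Fin 3 → ℤ)) =
      (t ^ 2) • (-(((ν * (4 * Real.pi ^ 2 * freqNormSq (k : Fin 3 → ℤ)) : ℝ) : ℂ) • Cc (k : Fin 3 → ℤ))) := by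
    rw [Pi.smul_apply, ← Complex.coe_smul, ← Complex.coe_smul, smul_smul, smul_neg, smul_smul, ← neg_smul,
      ← neg_smul]
    congr 1
    push_cast
    ring
  rw [hconv, hstokes, Pi.zero_apply, zero_sub, zero_sub, leraySym_neg, leraySym_neg, leraySym_real_smul, smul_add,
    smul_neg, smul_neg]

/-- **coat_chart_onto** (the coat chart is onto).  Every Galerkin steady state `c ∈ galerkinSubspace (modes N)`
of a real solenoidal force vector `C` at viscosity `ν` with positive dissipation `D := dissipation ν c` is a gauged
amplitude-clamped coat over `C`: with `α := energy C / D`, `h := α • c - C` is real solenoidal and `ℓ²`-orthogonal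
to `C` (power identity `D = ∑ Re⟪C k, c k⟫`, `dissipation_eq_power`), and the unforced residual of `C + h = α • c`
at viscosity `α ν` is `(-(α²)) • C` (affinity of `galerkinRHS` in the force, `leraySym_of_transversal`, and the
bidegree-`(1, 2)` homogeneity `coat_chart_onto_galerkinRHS_smul`). [folklore] -/
theorem coat_chart_onto : ∀ (N : ℕ) (C c : ↥(modes (Fin 3) N) → EuclideanSpace ℂ (Fin 3)) (ν : ℝ), C ∈ galerkinSubspace (modes (Fin 3) N) → c ∈ galerkinSubspace (modes (Fin 3) N) → galerkinRHS (modes (Fin 3) N) ν C c = 0 → 0 < dissipation ν c → (energy C / dissipation ν c) • c - C ∈ galerkinSubspace (modes (Fin 3) N) ∧ (∑ k, (inner ℂ (C k) (((energy C / dissipation ν c) • c - C) k)).re) = 0 ∧ galerkinRHS (modes (Fin 3) N) (energy C / dissipation ν c * ν) 0 (C + ((energy C / dissipation ν c) • c - C)) = (-((energy C / dissipation ν c) ^ 2)) • C := by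
  intro N C c ν hC hc h0 hD
  have hS : ∀ k ∈ modes (Fin 3) N, -k ∈ modes (Fin 3) N := modes_symm N
  -- the power identity of the steady state `c` of the force `C`
  have hpow : dissipation ν c = ∑ k, (inner ℂ (C k) (c k)).re :=
    Summit.AnomalousDissipation.AnomalousDissipation.Theorems.LaminarNeverLoud.Negative.dissipation_eq_power hS hC.1
      hc h0
  -- the unforced residual of `c` is `-C` (`galerkinRHS` is affine in the force, `Π C = C`)
  have hres : galerkinRHS (modes (Fin 3) N) ν 0 c = -C := by
    funext k
    have hk := congrFun h0 k
    have haff : galerkinRHS (modes (Fin 3) N) ν C c k =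
        galerkinRHS (modes (Fin 3) N) ν 0 c k + leraySym (k : Fin 3 → ℤ) (coeffExt (modes (Fin 3) N) C k) := by
      simp only [galerkinRHS_apply, galerkinField_def, coeffExt_zero, Pi.zero_apply, zero_sub, leraySym_sub,
        leraySym_neg]
      abel
    rw [haff, coeffExt_coe, leraySym_of_transversal (hC.2 k)] at hk
    rw [Pi.neg_apply]
    exact eq_neg_of_add_eq_zero_left hk
  have hD0 : dissipation ν c ≠ 0 := hD.ne'
  set α : ℝ := energy C / dissipation ν c with hα
  have hαD : α * dissipation ν c = energy C := by
    rw [hα]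
    exact div_mul_cancel₀ (energy C) hD0
  refine ⟨(galerkinSubspace _).sub_mem ((galerkinSubspace _).smul_mem α hc) hC, ?_, ?_⟩
  · -- orthogonality: `∑ Re⟪C k, (α c - C) k⟫ = α D - energy C = 0`
    have hterm : ∀ k : ↥(modes (Fin 3) N),
        (inner ℂ (C k) ((α • c - C) k)).re = α * (inner ℂ (C k) (c k)).re - ‖C k‖ ^ 2 := by
      intro k
      have e1 : (α • c - C) k = Complex.ofReal α • c k - C k := by
        rw [Pi.sub_apply, Pi.smul_apply, RCLike.real_smul_eq_coe_smul (K := ℂ)]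
        rfl
      have e2 : (inner ℂ (C k) (C k)).re = ‖C k‖ ^ 2 := by
        rw [← RCLike.re_to_complex, inner_self_eq_norm_sq]
      rw [e1, inner_sub_right, inner_smul_right, Complex.sub_re, Complex.mul_re, Complex.ofReal_re,
        Complex.ofReal_im, zero_mul, sub_zero, e2]
    rw [Finset.sum_congr rfl fun k _ => hterm k, Finset.sum_sub_distrib, ← Finset.mul_sum, ← hpow, hαD]
    unfold energy
    exact sub_self _
  · -- residual: `C + (α c - C) = α c` and `V(αν, 0)(α c) = α² V(ν, 0)(c) = α² • (-C)`
    rw [add_sub_cancel, coat_chart_onto_galerkinRHS_smul, hres, smul_neg, neg_smul]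

end Summit.AnomalousDissipation.AnomalousDissipation.Theorems.GalerkinSteadyZerothLaw

end

-- buildfix 2026-08-20 (ops-buildfix-1 gen 7): enqueue-only re-land — rebuild after B-35 (StokesArc, p233893) healed this module's import closure; no declaration changed.
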